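import Summits.BirchSwinnertonDyer.Rank1Residual.GaloisImage.PropagatedConditionCount
import HarnessLib

/-!
# `#𝓕_can(E[p])_v = #E(ℚ_v)[p] · #(𝓞_v/p)²` from Tate's local Euler–Poincaré characteristic ALONE —
# the located local gap (Lp) of the N11 hypothesis side DISCHARGED
# (cell `b2b-bsdres`, team n1011, row T-Lp; seat n1011-p04 gen 5; skeleton `cells/n1011/skel/T-Lp.md` S7–S8)

HONEST FRAMING (cell `b2b-bsdres`, run/shared/lean/b2b/bsd-rank1-residual/, verbatim in every
file): the goal of the cell is to DELETE the COMBINATION-SHAPED residual classes of the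
Birch–Swinnerton-Dyer formula for ALL analytic-rank `≤ 1` elliptic curves over `ℚ` — "full BSD
formula for every rank `≤ 1` curve in class `C`" assembled STRICTLY from published theorems — so
that the rank-`≤ 1` remainder becomes exactly the CONSTRUCTION-SHAPED classes, which are TYPED
(missing-input `Prop`s), NOT attempted. This is not "finishing BSD". Team n1011 (X4 ∧ `p = 3`,
§I N11; row T-a3-F1 = the hypothesis side of Sakamoto 2024 Thm. 4.4 for `(E[3^{k+1}], 𝓕_can)`):
research route; theorems only; no definition, no named fact, no `sorry`; nothing booked; no label
changes.

## What

n1011-p13's core-rank theorem `hasCoreRank_one_propagatedSelmerStructureOne` (`χ(𝓕̄_can) = 1`,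
hypothesis of Sakamoto Thm. 4.4) and the level-one N11 instance
(`SakamotoN11InstanceLevelOneInputs.lean`) carry ONE located local gap, in referee-1's print shape
(ruling (Lp) 2026-08-21): `hLpIm : #im(H¹(ℚ₃, T₃E) → H¹(ℚ₃, E[3])) = 9 · #E(ℚ₃)[3]` (Greenberg,
LNM 1716 §2 — "`rank_{ℤ₃} H¹(ℚ₃, T₃E) = 2`"; Milne *ADT* I 3.2/3.3).  This file PROVES it — at every
finite place `v` of `ℚ`, for every prime `p`, with NO reduction / image hypothesis — from Tate's
local Euler–Poincaré characteristic `hEP : localEulerPoincareCharacteristic ℚ_v` (Milne I Thm. 2.8;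
the named fact the consumers ALREADY carry) alone:

* `map_propagatedSelmerStructureOne_le` : the image of `𝓕̄_v` in `X = H¹(ℚ_v, E(ℚ̄_v))` lies in
  every `D_N = p^N • X[p^{N+1}]` (sibling `PropagatedConditionLevels`, S3);
* `mem_map_propagatedSelmerStructureOne_of_forall_mem` : conversely `⋂_N D_N` lies in that image
  (Kummer surjectivity `H¹(ℚ_v, E[p^{N+1}]) ↠ X[p^{N+1}]`, tree
  `exists_map_torsionPointsMapIntertwining_eq_of_zsmul_eq_zero`, Silverman X.§4 (**), with S2 and
  Kőnig S4 of the sibling file);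
* `natCard_propagatedSelmerStructureOne_mul` : `#𝓕̄_v = #𝒦_v · #(image)` (`ker(φ_p|𝓕̄_v) = 𝒦_v`,
  n1011-p18 `kummerSelmerStructure_le_propagatedSelmerStructureOne`);
* **`natCard_propagatedSelmerStructureOne_inr_of_localEuler`** :
  `#𝓕_can(E[p])_v = #E(ℚ_v)[p] · #(𝓞_v/p) · #(𝓞_v/p)` (with the stabilisation
  `exists_level_map_pow_smul_torsionBy_stable` of the sibling `PropagatedConditionCount` and
  `#𝒦_v = #E(ℚ_v)[p] · #(𝓞_v/p)`, Milne I Lemma 3.3, tree `natCard_kummerSelmerStructure_inr`);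
* `natCard_propagatedSelmerStructureOne_of_mem` : `= p² · #E(ℚ_v)[p]` at the place `v ∣ p`;
* **`natCard_propagatedSelmerStructureOne_three`** : `= 9 · #E(ℚ₃)[3]` — p13's `hLpIm` VERBATIM;
* `propagatedSelmerStructureOne_inr_eq_kummer_of_not_mem_of_localEuler` : `𝓕̄_v = 𝒦_v` at `v ∤ p`
  (n1011-p06's (Lℓ) equality, here from `hEP` instead of the bounded-exponent binder).

References: R. Greenberg, LNM 1716 (1999) §2; J. S. Milne, *ADT* I Thm. 2.8, Thm. 3.2, Lemma 3.3
[MilneADT2006]; K. Rubin, PCMS 18 (2011) §3.1 [Rubin2011]; R. Sakamoto, JTNB 36 (2024) Def. 3.6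
[Sakamoto2024]; J. H. Silverman, *AEC* VII.6.3, X.§4 [SilvermanAEC2009].
-/

noncomputable section

open scoped Classical NumberField ContRepresentation
open Field NumberField IsDedekindDomain Function
open WeierstrassCurve Literature.NumberTheory.EllipticCurves Literature.NumberTheory.GaloisRepresentations
  Literature.NumberTheory.GaloisRepresentations.DiscreteGaloisModule

namespace Summit.BirchSwinnertonDyer.Rank1Residual.GaloisImage

variable (W : WeierstrassCurve ℚ) [W.IsElliptic] (p : ℕ) [hp : Fact p.Prime]
  (v : HeightOneSpectrum (𝓞 ℚ))

/-! ### S7. The image of `𝓕̄_v` in `X = H¹(ℚ_v, E(ℚ̄_v))` is `⋂_N D_N` -/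

/-- **The image of `𝓕_can(E[p])_v` under `φ_p : H¹(ℚ_v, E[p]) → H¹(ℚ_v, E(ℚ̄_v))` lies in
`D_N = p^N • X[p^{N+1}]` for every `N`** (sibling S3, n1011-p06's (Lℓ) computation).
[cite: Rubin2011, §3.1 (p. 29)] -/
theorem map_propagatedSelmerStructureOne_le (N : ℕ) :
    (propagatedSelmerStructureOne W p (Sum.inr v)).map
        (galoisCohomology.map (W.torsionPointsMapIntertwining (p : ℤ)
          (Place.Completion (Sum.inr v : Place ℚ))) 1) ≤
      (AddSubgroup.torsionBy
        (galoisCohomology (W.localGaloisModule (Place.Completion (Sum.inr v : Place ℚ))) 1)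
        ((p ^ (N + 1) : ℕ) : ℤ)).map (zsmulAddGroupHom ((p ^ N : ℕ) : ℤ)) := by
  rintro _ ⟨x, hx, rfl⟩
  obtain ⟨c, hc, hxc⟩ := exists_map_torsionPointsMap_eq_pow_smul_of_mem W p N (Sum.inr v) hx
  refine ⟨c, ?_, ?_⟩
  · show c ∈ AddSubgroup.torsionBy _ _
    rw [AddSubgroup.torsionBy, Submodule.mem_toAddSubgroup, Submodule.mem_torsionBy_iff]
    exact hc
  · rw [zsmulAddGroupHom_apply]
    exact hxc.symm

/-- **Conversely, `⋂_N D_N` lies in the image of `𝓕̄_v`**: if `z ∈ p^N • X[p^{N+1}]` for every `N`,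
write `z = p^N • c_N`; Kummer surjectivity (`H¹(ℚ_v, E[p^N·p]) ↠ X[p^N·p]`, tree
`exists_map_torsionPointsMapIntertwining_eq_of_zsmul_eq_zero`) lifts `c_N` to `y_N ∈ H¹(ℚ_v, E[p^N·p])`
with `φ_p (red_N y_N) = z` (sibling S2); all `red_N y_N` differ from `x₀ := red_0 y_0` by elements of
`ker φ_p = 𝒦_v ≤ 𝓕̄_v ≤ im red_N` (n1011-p18, sibling S1), so `x₀ ∈ im red_N` for every `N`, hence
`x₀ ∈ 𝓕̄_v` by Kőnig (sibling S4) and `z = φ_p x₀`. [cite: SilvermanAEC2009, X.§4 diagram (**)] -/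
theorem mem_map_propagatedSelmerStructureOne_of_forall_mem
    {z : galoisCohomology (W.localGaloisModule (Place.Completion (Sum.inr v : Place ℚ))) 1}
    (hz : ∀ N : ℕ, z ∈ (AddSubgroup.torsionBy
        (galoisCohomology (W.localGaloisModule (Place.Completion (Sum.inr v : Place ℚ))) 1)
        ((p ^ (N + 1) : ℕ) : ℤ)).map (zsmulAddGroupHom ((p ^ N : ℕ) : ℤ))) :
    z ∈ (propagatedSelmerStructureOne W p (Sum.inr v)).map
        (galoisCohomology.map (W.torsionPointsMapIntertwining (p : ℤ)
          (Place.Completion (Sum.inr v : Place ℚ))) 1) := by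
  -- Kummer surjectivity at level `p^N · p` (the `CharZero` instance of `ℚ_v` is passed explicitly, so
  -- that the `ℚ`-algebra structure of `ℚ_v` stays the completion's own)
  have hsurj : ∀ (N : ℕ) (c : galoisCohomology (W.localGaloisModule
      (Place.Completion (Sum.inr v : Place ℚ))) 1), ((p : ℤ) ^ N * (p : ℤ)) • c = 0 →
      ∃ y : galoisCohomology ((W.torsionGaloisModule ((p : ℤ) ^ N * (p : ℤ))).toLocal
        (Sum.inr v : Place ℚ)) 1,
        galoisCohomology.map (W.torsionPointsMapIntertwining ((p : ℤ) ^ N * (p : ℤ))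
          (Place.Completion (Sum.inr v : Place ℚ))) 1 y = c := by
    intro N c hc
    have hn : (p : ℤ) ^ N * (p : ℤ) ≠ 0 :=
      mul_ne_zero (pow_ne_zero N (Nat.cast_ne_zero.mpr hp.out.ne_zero))
        (Nat.cast_ne_zero.mpr hp.out.ne_zero)
    exact @WeierstrassCurve.exists_map_torsionPointsMapIntertwining_eq_of_zsmul_eq_zero ℚ _ W
      (Place.Completion (Sum.inr v : Place ℚ)) _ _ _ _ ((p : ℤ) ^ N * (p : ℤ))
      (charZero_adicCompletion v) hn c hc
  -- lifts at every level
  have hlift : ∀ N : ℕ, ∃ x : galoisCohomology ((W.torsionGaloisModule (p : ℤ)).toLocal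
      (Sum.inr v : Place ℚ)) 1,
      x ∈ (DiscreteGaloisModule.localMap (W.torsionMulBy ((p : ℤ) ^ N) (p : ℤ))
        (Sum.inr v : Place ℚ)).range ∧
      galoisCohomology.map (W.torsionPointsMapIntertwining (p : ℤ)
        (Place.Completion (Sum.inr v : Place ℚ))) 1 x = z := by
    intro N
    obtain ⟨c, hc, hcz⟩ := hz N
    have hc' : ((p : ℤ) ^ N * (p : ℤ)) • c = 0 := by
      have h := (Submodule.mem_torsionBy_iff _ _).mp hc
      have hcast : ((p ^ (N + 1) : ℕ) : ℤ) = (p : ℤ) ^ N * (p : ℤ) := by push_cast; ring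
      rw [hcast] at h
      exact h
    obtain ⟨y, hy⟩ := hsurj N c hc'
    refine ⟨DiscreteGaloisModule.localMap (W.torsionMulBy ((p : ℤ) ^ N) (p : ℤ)) (Sum.inr v) y,
      ⟨y, rfl⟩, ?_⟩
    rw [map_torsionPointsMap_localMap_torsionMulBy, hy, ← hcz, zsmulAddGroupHom_apply]
  -- `x₀` at level `0` lifts to every level
  obtain ⟨x₀, -, hx₀⟩ := hlift 0
  have hx₀N : ∀ N : ℕ, x₀ ∈ (DiscreteGaloisModule.localMap (W.torsionMulBy ((p : ℤ) ^ N) (p : ℤ))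
      (Sum.inr v : Place ℚ)).range := by
    intro N
    obtain ⟨xN, hxN, hxNz⟩ := hlift N
    -- `xN - x₀ ∈ ker φ_p = 𝒦_v ≤ 𝓕̄_v ≤ im red_N`
    have hdiff : xN - x₀ ∈ W.kummerSelmerStructure (p : ℤ) (Sum.inr v) := by
      refine (W.mem_kummerLocalConditionAt_iff (p : ℤ) (Place.Completion (Sum.inr v : Place ℚ)) _).mpr ?_
      have h1 := map_sub (galoisCohomology.map (W.torsionPointsMapIntertwining (p : ℤ)
        (Place.Completion (Sum.inr v : Place ℚ))) 1) xN x₀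
      have h2 : galoisCohomology.map (W.torsionPointsMapIntertwining (p : ℤ)
            (Place.Completion (Sum.inr v : Place ℚ))) 1 xN -
          galoisCohomology.map (W.torsionPointsMapIntertwining (p : ℤ)
            (Place.Completion (Sum.inr v : Place ℚ))) 1 x₀ = 0 := by
        rw [hxNz, hx₀, sub_self]
      exact h1.trans h2
    have hmem := propagatedSelmerStructureOne_le_range_localMap W p N (Sum.inr v)
      (kummerSelmerStructure_le_propagatedSelmerStructureOne W p (Sum.inr v) hdiff)
    have h := sub_mem hxN hmem
    rwa [sub_sub_cancel] at h
  exact ⟨x₀, mem_propagatedSelmerStructureOne_of_forall_mem_range W p v hx₀N, hx₀⟩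

/-! ### S8. The count -/

/-- **`#𝓕̄_v = #𝒦_v · #φ_p(𝓕̄_v)`**: restricted to `𝓕_can(E[p])_v`, the change of coefficients
`φ_p : H¹(ℚ_v, E[p]) → H¹(ℚ_v, E(ℚ̄_v))` has kernel the local Kummer condition `𝒦_v = ker φ_p`
(which lies in `𝓕̄_v`, n1011-p18 `kummerSelmerStructure_le_propagatedSelmerStructureOne`); first
isomorphism theorem. [cite: SilvermanAEC2009, X.§4 diagram (**)] -/
theorem natCard_propagatedSelmerStructureOne_mul :
    Nat.card (propagatedSelmerStructureOne W p (Sum.inr v)) =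
      Nat.card (W.kummerSelmerStructure (p : ℤ) (Sum.inr v)) *
        Nat.card ((propagatedSelmerStructureOne W p (Sum.inr v)).map
          (galoisCohomology.map (W.torsionPointsMapIntertwining (p : ℤ)
            (Place.Completion (Sum.inr v : Place ℚ))) 1)) := by
  set F := propagatedSelmerStructureOne W p (Sum.inr v) with hF
  set φ := galoisCohomology.map (W.torsionPointsMapIntertwining (p : ℤ)
    (Place.Completion (Sum.inr v : Place ℚ))) 1 with hφ
  have hle : W.kummerSelmerStructure (p : ℤ) (Sum.inr v) ≤ F :=
    kummerSelmerStructure_le_propagatedSelmerStructureOne W p (Sum.inr v)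
  let ψ : F →+ _ := φ.comp F.subtype
  have hrange : ψ.range = F.map φ := by
    ext y
    constructor
    · rintro ⟨x, rfl⟩
      exact ⟨x.1, x.2, rfl⟩
    · rintro ⟨x, hx, rfl⟩
      exact ⟨⟨x, hx⟩, rfl⟩
  have hker : ψ.ker = (W.kummerSelmerStructure (p : ℤ) (Sum.inr v)).addSubgroupOf F := by
    ext x
    rw [AddMonoidHom.mem_ker, AddSubgroup.mem_addSubgroupOf]
    exact (W.mem_kummerLocalConditionAt_iff (p : ℤ) (Place.Completion (Sum.inr v : Place ℚ)) _).symm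
  rw [AddSubgroup.card_eq_card_quotient_mul_card_addSubgroup ψ.ker,
    Nat.card_congr (QuotientAddGroup.quotientKerEquivRange ψ).toEquiv, hrange, hker,
    Nat.card_congr (AddSubgroup.addSubgroupOfEquivOfLe hle).toEquiv, mul_comm]

/-- **(Lp) at every finite place, from `hEP` alone:
`#𝓕_can(E[p])_v = #E(ℚ_v)[p] · #(𝓞_v/p) · #(𝓞_v/p)`.**  The image of `𝓕̄_v` in `H¹(ℚ_v, E(ℚ̄_v))`
is the stable subgroup `D_{N₀}` of order `#(𝓞_v/p)` (`map_propagatedSelmerStructureOne_le`,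
`mem_map_propagatedSelmerStructureOne_of_forall_mem`, `exists_level_map_pow_smul_torsionBy_stable`),
and `#𝒦_v = #E(ℚ_v)[p] · #(𝓞_v/p)` (Milne I Lemma 3.3, tree `natCard_kummerSelmerStructure_inr`).
Greenberg, LNM 1716 §2 (`H¹(ℚ_p, T_pE) ≅ ℤ_p² ⊕ E(ℚ_p)[p^∞]`); Milne *ADT* I Thm. 2.8 / 3.2 / Lemma 3.3.
[cite: MilneADT2006, Ch. I, Thm. 3.2 and Lemma 3.3] -/
theorem natCard_propagatedSelmerStructureOne_inr_of_localEuler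
    (hEP : localEulerPoincareCharacteristic (v.adicCompletion ℚ)) :
    Nat.card (propagatedSelmerStructureOne W p (Sum.inr v)) =
      Nat.card (nsmulAddMonoidHom p : (W.baseChange (v.adicCompletion ℚ)).toAffine.Point →+ _).ker *
        Nat.card (v.adicCompletionIntegers ℚ ⧸ Ideal.span {((p : ℕ) : v.adicCompletionIntegers ℚ)}) *
        Nat.card (v.adicCompletionIntegers ℚ ⧸ Ideal.span {((p : ℕ) : v.adicCompletionIntegers ℚ)}) := by
  obtain ⟨N₀, -, hle, hcard⟩ := exists_level_map_pow_smul_torsionBy_stable W p v hEP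
  have himage : (propagatedSelmerStructureOne W p (Sum.inr v)).map
      (galoisCohomology.map (W.torsionPointsMapIntertwining (p : ℤ)
        (Place.Completion (Sum.inr v : Place ℚ))) 1) =
      (AddSubgroup.torsionBy
        (galoisCohomology (W.localGaloisModule (Place.Completion (Sum.inr v : Place ℚ))) 1)
        ((p ^ (N₀ + 1) : ℕ) : ℤ)).map (zsmulAddGroupHom ((p ^ N₀ : ℕ) : ℤ)) :=
    le_antisymm (map_propagatedSelmerStructureOne_le W p v N₀)
      fun z hz => mem_map_propagatedSelmerStructureOne_of_forall_mem W p v fun N => hle N hz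
  rw [natCard_propagatedSelmerStructureOne_mul, himage, hcard,
    W.natCard_kummerSelmerStructure_inr v hp.out.ne_zero]

/-- **(Lp) at the place `v ∣ p` of `ℚ`: `#𝓕_can(E[p])_{(p)} = p² · #E(ℚ_p)[p]`** (`#(ℤ_p/p) = p`).
Greenberg, LNM 1716 §2; Milne *ADT* I Thm. 2.8 / 3.2 / Lemma 3.3. [cite: MilneADT2006, Ch. I, Thm. 3.2 and Lemma 3.3] -/
theorem natCard_propagatedSelmerStructureOne_of_mem
    (hEP : localEulerPoincareCharacteristic (v.adicCompletion ℚ)) (hv : ((p : ℕ) : 𝓞 ℚ) ∈ v.asIdeal) :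
    Nat.card (propagatedSelmerStructureOne W p (Sum.inr v)) =
      p ^ 2 * Nat.card (nsmulAddMonoidHom p : (W.baseChange (v.adicCompletion ℚ)).toAffine.Point →+ _).ker := by
  rw [natCard_propagatedSelmerStructureOne_inr_of_localEuler W p v hEP,
    natCard_quot_adicCompletionIntegers_of_prime_mem p hv]
  ring

/-- **(Lp) at `v ∤ p`: `𝓕_can(E[p])_v = 𝒦_v`** (`#(𝓞_v/p) = 1`, so `#𝓕̄_v = #𝒦_v` and `𝒦_v ≤ 𝓕̄_v`):
n1011-p06's (Lℓ) equality (`propagatedSelmerStructureOne_inr_eq_kummerSelmerStructure`), here from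
`hEP` in place of the bounded-exponent binder. [cite: MilneADT2006, Ch. I, Lemma 3.3] -/
theorem propagatedSelmerStructureOne_inr_eq_kummer_of_not_mem_of_localEuler
    (hEP : localEulerPoincareCharacteristic (v.adicCompletion ℚ)) (hv : ((p : ℕ) : 𝓞 ℚ) ∉ v.asIdeal) :
    propagatedSelmerStructureOne W p (Sum.inr v) = W.kummerSelmerStructure (p : ℤ) (Sum.inr v) := by
  haveI := W.finite_kummerSelmerStructure_inr v (n := p) hp.out.ne_zero
  have hq : Nat.card (v.adicCompletionIntegers ℚ ⧸
      Ideal.span {((p : ℕ) : v.adicCompletionIntegers ℚ)}) = 1 :=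
    natCard_quot_adicCompletionIntegers_eq_one_of_not_mem v hv
  have hcard : Nat.card (propagatedSelmerStructureOne W p (Sum.inr v)) =
      Nat.card (W.kummerSelmerStructure (p : ℤ) (Sum.inr v)) := by
    rw [natCard_propagatedSelmerStructureOne_inr_of_localEuler W p v hEP,
      W.natCard_kummerSelmerStructure_inr v hp.out.ne_zero, hq, mul_one, mul_one]
  haveI : Finite (propagatedSelmerStructureOne W p (Sum.inr v)) :=
    Nat.finite_of_card_ne_zero (by rw [hcard]; exact Nat.card_pos.ne')
  exact (AddSubgroup.eq_of_le_of_card_ge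
    (kummerSelmerStructure_le_propagatedSelmerStructureOne W p (Sum.inr v)) hcard.le).symm

/-! ### The N11 instance: `p = 3`, the binder `hLpIm` of n1011-p13 VERBATIM -/

/-- **(Lp) for N11 — p13's binder `hLpIm` DISCHARGED: `#𝓕_can(E[3])_{(3)} = 9 · #E(ℚ₃)[3]`** for
every elliptic curve `E/ℚ` at the place above `3`, from Tate's local Euler–Poincaré characteristic
at `ℚ₃` alone (referee-1 ruling (Lp), print shape (α): Greenberg LNM 1716 §2, Milne *ADT* I
Thm. 2.8 / 3.2 / Lemma 3.3).  Consumers: `hasCoreRank_one_propagatedSelmerStructureOne`,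
`kolyvaginSystems_freeRankOne_levelOne_of_surj_of_localInputs` (n1011-p13).
[cite: MilneADT2006, Ch. I, Thm. 3.2 and Lemma 3.3] -/
theorem natCard_propagatedSelmerStructureOne_three (W : WeierstrassCurve ℚ) [W.IsElliptic]
    (v : HeightOneSpectrum (𝓞 ℚ)) (hEP : localEulerPoincareCharacteristic (v.adicCompletion ℚ))
    (hv : ((3 : ℕ) : 𝓞 ℚ) ∈ v.asIdeal) :
    Nat.card (propagatedSelmerStructureOne W 3 (Sum.inr v)) =
      9 * Nat.card (nsmulAddMonoidHom 3 : (W.baseChange (v.adicCompletion ℚ)).toAffine.Point →+ _).ker := by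
  haveI : Fact (Nat.Prime 3) := ⟨Nat.prime_three⟩
  have h := natCard_propagatedSelmerStructureOne_of_mem W 3 v hEP hv
  norm_num at h
  exact h

end Summit.BirchSwinnertonDyer.Rank1Residual.GaloisImage

end
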